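import Summits.Ventures.PercRepro2.CaseOneMovesAnchors

/-!
# `ClosedAt` and `FourFormsAll` are the same property
(blind cell PercRepro2, p1 g22; the bridge between the relation files and the pendant-tree files)

`FourFormsAll R o a₁ a₂ b E ends v` (CaseOnePendantTreeMarks) quantifies over the `Fintype` /
`DecidableEq` instances of `E`; `ClosedAt R o a₁ a₂ b E ends v` (CaseOneThickeningRel) uses the ambient
ones. They are equivalent (`closedAt_iff_fourFormsAll`; the instances are subsingletons), so the
closure under pendant trees (`fourFormsAll_of_pendantTree_fourFormsAll`) and the closure under moves
(`closedAt_of_moves`) speak about one and the same closed set. Own code; standard axioms. -/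

namespace Summit.Ventures.PercRepro2

namespace CaseOne

universe u

section ClosedAtIff
variable {V : Type*} {R : Type*} [CommRing R] [LinearOrder R] (o a₁ a₂ b : V)
variable {E : Type u} [Fintype E] [DecidableEq E] {ends : E → Sym2 V} {v : V}

/-- `FourFormsAll` gives `ClosedAt`. -/
theorem closedAt_of_fourFormsAll (h : FourFormsAll R o a₁ a₂ b E ends v) :
    ClosedAt R o a₁ a₂ b E ends v :=
  fun p hp => h p hp

/-- `ClosedAt` gives `FourFormsAll` (the quantified instances are the ambient ones). -/
theorem fourFormsAll_of_closedAt (h : ClosedAt R o a₁ a₂ b E ends v) :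
    FourFormsAll R o a₁ a₂ b E ends v := by
  intro _ _ p hp
  have hh := h p hp
  convert hh using 2

/-- **`ClosedAt` and `FourFormsAll` are the same property.** -/
theorem closedAt_iff_fourFormsAll :
    ClosedAt R o a₁ a₂ b E ends v ↔ FourFormsAll R o a₁ a₂ b E ends v :=
  ⟨fourFormsAll_of_closedAt o a₁ a₂ b, closedAt_of_fourFormsAll o a₁ a₂ b⟩

end ClosedAtIff

end CaseOne

end Summit.Ventures.PercRepro2
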